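import Mathlib
import HarnessLib
import Literature.Probability.Distributions.PseudoMarginalGaussianNoise
import Summits.Ventures.LatticeQCDFlow.Scaling.GaussianWeights

/-!
# The log-normal acceptance law of exact flow-MCMC (IMH): `ā = erfc(σ/2) = 2Φ(−σ/√2)` —
# a dictionary to the pseudo-marginal Gaussian-noise law already in the tree

HONEST FRAMING: exact (Metropolis-corrected) sampling algorithms for lattice gauge theory;
figures of merit are autocorrelation/cost numbers at stated couplings and volumes; no
continuum-physics claim.

Venture `LatticeQCDFlow` (cell pub-lqcd), topic `Scoring`; flow seat (`pub-lqcd-flow`, gen-34).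
DICTIONARY FILE in the sense of the placement rule: the integral is the published one formalised in
`Literature/Probability/Distributions/PseudoMarginalGaussianNoise.lean` (Doucet–Pitt–Deligiannidis–
Kohn 2015, Corollary 3 = Pitt–Silva–Giordani–Kohn 2012, Lemma 4; the same integral is Knechtli–Wolff
2003 (3.13), `Literature/…/GaussianMetropolisAcceptance.lean`) and the Kish leg is the tree's T2-J
(`Scaling/GaussianWeights.lean`, `Theory2.gaussian_logweight_ess`); what is NEW here is only the
identification and the packaging, which three tree files name as missing ("`acc_IMH = 2Φ(−σ/√2)`
for `W − ΔF ∼ N(σ²/2, σ²)` … a continuum dictionary … NOT typed", `Exactness/NCMCAcceptance.lean`;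
"the independence-Metropolis acceptance (an `erfc`-type integral, not typed)",
`Scoring/FreeFieldFlowESS.lean`; "the `erfc` acceptance formula is not typed",
`Scaling/GaussianWeights.lean`).  Nothing is cited as a fact; no definition is added.

## The dictionary

Exact flow-MCMC is the Metropolised independence sampler (IMH) with importance weight `w = p/q`;
its stationary mean acceptance is the `q ⊗ q` expectation of the MIN OF TWO INDEPENDENT PROPOSAL
WEIGHTS, `ā = Σ_x Σ_y q_x q_y min(w_x, w_y)` (finite form: `Scoring/IMHAcceptanceFromWeights.lean`,
`accRate_eq_qq_min_weight`).  In the LOG-NORMAL MODEL of a trained flow — `ℓ = log w ∼ N(m, s)`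
under the model `q`, normalised `E_q[w] = 1`, whence `m = −s/2` (T2-J `gaussian_logweight_law`) —
the q-law of `ℓ` is LITERALLY `PseudoMarginalNoise.noiseLaw s = N(−s/2, s)` (the law `g^σ` of a
FRESH log-noise, `σ² = s`), the law of `ℓ` under the TARGET `p = w·q = e^ℓ q` is the tilt
`PseudoMarginalNoise.tiltedLaw s = N(+s/2, s)` (the law `π_Z^σ` of the RECYCLED noise;
`integral_exp_mul_noiseLaw` below, for an arbitrary test function), and the IMH ratio
`min(1, w(y)/w(x))` from the current state `x ∼ p` to a fresh proposal `y ∼ q` is the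
pseudo-marginal noise ratio `min{1, e^{w − z}}` with the PERFECT proposal (`r_EX ≡ 1`): flow-IMH
with log-normal weights IS Doucet–Pitt–Deligiannidis–Kohn's perfect-proposal pseudo-marginal
chain, `σ² = Var_q(log w)`.

## What is proved (`s = σ² ≠ 0` unless stated)

* `integral_exp_mul_noiseLaw` — `∫ e^x g(x) N(−s/2, s)(dx) = ∫ g N(s/2, s)(dx)` for EVERY
  `g : ℝ → ℝ` (no measurability needed: both sides are density integrals): "the law of `log w` under
  the target
  is the mirror Gaussian" (what `HOME/canary-flow/imhlaw/imhlaw.py` `ln_dictionary` states as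
  "`ln W ∼ N(σ²/2, σ²)` under `π`");
* **`imh_lognormal_accRate_eq_noiseAccept`** — THE DICTIONARY:
  `∫∫ min(e^x, e^y) N(−s/2,s)(dx) N(−s/2,s)(dy) = ∫∫ min{1, e^{w−z}} g^σ(dw) π_Z^σ(dz)`;
* **`imh_lognormal_accRate_eq_erfc`** — `ā = (2/√π) ∫_{σ/2}^{∞} e^{−u²} du  (= erfc(σ/2))`;
  **`imh_lognormal_accRate_eq_two_mul_cdf`** — `ā = 2Φ(−σ/√2)` (the form `imhlaw.py` computes,
  "`abar = 2 Phi(-sigma/sqrt2)`"); `imh_lognormal_accRate_lt_one` (`ā < 1` for `σ > 0`),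
  `imh_lognormal_accRate_zero` (`σ = 0`, a perfect flow: `ā = 1`),
  `imh_lognormal_accRate_strictAnti` (`ā` strictly decreasing in `σ²`: the scorers' inverse `σ(ā)`
  is well defined);
* **`imh_lognormal_dictionary`** — packaged over an abstract model space exactly as T2-J is stated:
  if `ℓ : Ω → ℝ` has law `N(m, v)` under `P` (`v ≠ 0`) and `mgf ℓ P 1 = 1` (normalised weights),
  then `ESS/N = (E w)²/E w² = e^{−v}` (T2-J, restated) AND
  `E_{P⊗P}[min(e^{ℓ}, e^{ℓ′})] = (2/√π) ∫_{√v/2}^{∞} e^{−u²} du`: the pair (Kish, ā) of the scorers'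
  log-normal dictionary (`PREDICTIONS-REGISTER-flow.md` rows P-I5 / P-I5′:
  `Kish_LN(ā) = exp(−σ(ā)²)` with `σ(ā)` solving `ā = 2Φ(−σ/√2)`) is ONE parameter
  `σ² = Var_q(log w)` read two ways.

NOT CLAIMED: that a trained flow's log-weight is Gaussian (it is a model — the regime reported at
large volume, where `log w` is a sum of many weakly dependent local terms; the scorers GRADE pools
LAW / FLOOR / FROZEN before applying it); anything about autocorrelations (the `τ` legs of the
register are `Scoring/IMHLiuSpectrum*.lean`, `IMHPoissonTransfer.lean`, `IMHGreenKubo.lean`).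
-/

namespace Summit.Ventures.LatticeQCDFlow.Scoring

open MeasureTheory ProbabilityTheory Set
open scoped NNReal ENNReal
open Literature.Probability.Distributions
open Literature.Probability.Distributions.PseudoMarginalNoise

section LogNormalIMH

variable {s : ℝ≥0}

/-- **The law of the log-weight under the target is the mirror Gaussian** — for EVERY test function
`g` (no measurability or integrability hypothesis: both sides are integrals against a density),
`∫ e^x g(x) N(−s/2, s)(dx) = ∫ g(x) N(s/2, s)(dx)`; i.e. `E_p[g(log w)] = E_q[w·g(log w)]`
evaluated in the log-normal model.  The density identity is the tree's
`PseudoMarginalNoise.exp_mul_gaussianPDFReal_noise` (Doucet et al. 2015, Cor. 3, first clause). -/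
theorem integral_exp_mul_noiseLaw (hs : s ≠ 0) (g : ℝ → ℝ) :
    ∫ x, Real.exp x * g x ∂(noiseLaw s) = ∫ x, g x ∂(tiltedLaw s) := by
  rw [noiseLaw, tiltedLaw, integral_gaussianReal_eq_integral_smul hs,
    integral_gaussianReal_eq_integral_smul hs]
  refine integral_congr_ae (ae_of_all _ fun x => ?_)
  simp only [smul_eq_mul]
  rw [← mul_assoc, mul_comm (gaussianPDFReal _ _ _), exp_mul_gaussianPDFReal_noise hs]

/-- Pointwise: `min(e^x, e^y) = e^x · min(1, e^{y − x})`. [folklore] -/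
theorem min_exp_exp_eq (x y : ℝ) :
    min (Real.exp x) (Real.exp y) = Real.exp x * min 1 (Real.exp (y - x)) := by
  rw [mul_min_of_nonneg _ _ (Real.exp_pos x).le, mul_one, ← Real.exp_add, add_sub_cancel]

/-- **The dictionary.**  The `q ⊗ q` expectation of the min of two independent log-normal weights
(`log w ∼ N(−s/2, s)` under the model, `E_q w = 1`) — the stationary IMH acceptance of exact
flow-MCMC in the log-normal model — equals the stationary noise acceptance
`∬ min{1, e^{w−z}} g^σ(dw) π_Z^σ(dz)` of the perfect-proposal pseudo-marginal chain with Gaussian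
log-noise of variance `σ² = s` (`Literature/…/PseudoMarginalGaussianNoise.lean`): factor `e^x` out
of the min and move it onto the measure (`integral_exp_mul_noiseLaw`). -/
theorem imh_lognormal_accRate_eq_noiseAccept (hs : s ≠ 0) :
    ∫ x, ∫ y, min (Real.exp x) (Real.exp y) ∂(noiseLaw s) ∂(noiseLaw s) =
      ∫ z, ∫ w, min 1 (Real.exp (w - z)) ∂(noiseLaw s) ∂(tiltedLaw s) := by
  have hinner : ∀ x, ∫ y, min (Real.exp x) (Real.exp y) ∂(noiseLaw s) =
      Real.exp x * ∫ y, min 1 (Real.exp (y - x)) ∂(noiseLaw s) := by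
    intro x
    rw [← integral_const_mul]
    exact integral_congr_ae (ae_of_all _ fun y => min_exp_exp_eq x y)
  simp_rw [hinner]
  exact integral_exp_mul_noiseLaw hs _

/-- **`ā = erfc(σ/2)`**: in the log-normal model with log-weight variance `s = σ² > 0` under the
model, the stationary IMH acceptance of exact flow-MCMC is
`E_{q⊗q}[min(w, w′)] = (2/√π) ∫_{σ/2}^{∞} e^{−u²} du` (DLMF 7.2.2: `= erfc(σ/2)`).  The integral is
Doucet–Pitt–Deligiannidis–Kohn's Corollary 3 / Knechtli–Wolff's (3.13), by name. -/
theorem imh_lognormal_accRate_eq_erfc (hs : s ≠ 0) :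
    ∫ x, ∫ y, min (Real.exp x) (Real.exp y) ∂(noiseLaw s) ∂(noiseLaw s) =
      2 / Real.sqrt Real.pi * ∫ u in Ioi (Real.sqrt (s : ℝ) / 2), Real.exp (-u ^ 2) := by
  rw [imh_lognormal_accRate_eq_noiseAccept hs, integral_noiseAccept_eq_erfc hs]

/-- **`ā = 2Φ(−σ/√2)`** — the form the cell's IMH-law scorer computes
(`imhlaw.py`: "`abar = 2 Phi(-sigma/sqrt2)`"), `Φ(t) = N(0,1)(−∞, t]`. -/
theorem imh_lognormal_accRate_eq_two_mul_cdf (hs : s ≠ 0) :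
    ∫ x, ∫ y, min (Real.exp x) (Real.exp y) ∂(noiseLaw s) ∂(noiseLaw s) =
      2 * (gaussianReal 0 1 (Iic (-(Real.sqrt (s : ℝ) / Real.sqrt 2)))).toReal := by
  rw [imh_lognormal_accRate_eq_noiseAccept hs, integral_noiseAccept_eq_two_mul_cdf hs]

/-- With log-normal weights of positive log-variance even the exact chain of a trained flow cannot
accept every proposal: `ā < 1`. -/
theorem imh_lognormal_accRate_lt_one (hs : s ≠ 0) :
    ∫ x, ∫ y, min (Real.exp x) (Real.exp y) ∂(noiseLaw s) ∂(noiseLaw s) < 1 := by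
  rw [imh_lognormal_accRate_eq_noiseAccept hs]
  exact integral_noiseAccept_lt_one hs

/-- **`ā` is strictly decreasing in the log-weight variance** (`σ ↦ erfc(σ/2)`): the inverse
`σ(ā)` the scorers use (`imhlaw.py` `sigma_from_abar`, by bisection) is well defined, so the P-I5
dictionary `Kish_LN(ā) = exp(−σ(ā)²)` is a FUNCTION of the measured acceptance. -/
theorem imh_lognormal_accRate_strictAnti {s s' : ℝ≥0} (hs : s ≠ 0) (hlt : s < s') :
    ∫ x, ∫ y, min (Real.exp x) (Real.exp y) ∂(noiseLaw s') ∂(noiseLaw s') <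
      ∫ x, ∫ y, min (Real.exp x) (Real.exp y) ∂(noiseLaw s) ∂(noiseLaw s) := by
  have hs' : s' ≠ 0 := (zero_le.trans_lt hlt).ne'
  rw [imh_lognormal_accRate_eq_erfc hs, imh_lognormal_accRate_eq_erfc hs']
  have hpi : 0 < 2 / Real.sqrt Real.pi := div_pos two_pos (Real.sqrt_pos.mpr Real.pi_pos)
  apply mul_lt_mul_of_pos_left _ hpi
  have hab : Real.sqrt (s : ℝ) / 2 < Real.sqrt (s' : ℝ) / 2 :=
    div_lt_div_of_pos_right (Real.sqrt_lt_sqrt (by positivity) (by exact_mod_cast hlt)) two_pos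
  have hint : IntegrableOn (fun u : ℝ => Real.exp (-u ^ 2)) (Ioi (Real.sqrt (s : ℝ) / 2)) := by
    have h1 := (integrable_exp_neg_mul_sq (b := (1 : ℝ)) one_pos).integrableOn
      (s := Ioi (Real.sqrt (s : ℝ) / 2))
    simpa only [neg_mul, one_mul] using h1
  have hsub := intervalIntegral.integral_Ioi_sub_Ioi hint hab.le
  have hpos : 0 < ∫ u in (Real.sqrt (s : ℝ) / 2)..(Real.sqrt (s' : ℝ) / 2), Real.exp (-u ^ 2) :=
    intervalIntegral.intervalIntegral_pos_of_pos
      ((by fun_prop : Continuous fun u : ℝ => Real.exp (-u ^ 2)).intervalIntegrable _ _)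
      (fun u => Real.exp_pos _) hab
  linarith

/-- The perfect flow (`s = 0`: `w ≡ 1`, `q = p`) accepts everything: `ā = 1`. -/
theorem imh_lognormal_accRate_zero :
    ∫ x, ∫ y, min (Real.exp x) (Real.exp y) ∂(noiseLaw 0) ∂(noiseLaw 0) = 1 := by
  simp [noiseLaw, gaussianReal_zero_var, integral_dirac]

end LogNormalIMH

section Dictionary

/-- **The log-normal dictionary of the flow scorers, both legs, over an abstract model space** (the
interface of T2-J, `Scaling/GaussianWeights.lean`): if the log-weight `ℓ = log w` of a model draw is
Gaussian `N(m, v)` (`v ≠ 0`) and the weights are normalised (`E[e^ℓ] = mgf ℓ P 1 = 1`), then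
(i) `ESS/N = (E w)²/E[w²] = e^{−v}` (T2-J `Theory2.gaussian_logweight_ess`, restated), and
(ii) the stationary IMH acceptance, the `P ⊗ P` mean of `min(e^{ℓ}, e^{ℓ′})` over two independent
draws, is `(2/√π) ∫_{√v/2}^{∞} e^{−u²} du = erfc(σ/2) = 2Φ(−σ/√2)`, `σ² = v` — ONE parameter read
two ways, which is what the register's P-I5 rows use (`Kish_LN(ā) = exp(−σ(ā)²)`). -/
theorem imh_lognormal_dictionary {Ω : Type*} [MeasurableSpace Ω] {P : Measure Ω}
    [IsProbabilityMeasure P] {ℓ : Ω → ℝ} (hℓm : AEMeasurable ℓ P) {m : ℝ} {v : ℝ≥0} (hv : v ≠ 0)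
    (hℓ : P.map ℓ = gaussianReal m v) (hnorm : mgf ℓ P 1 = 1) :
    mgf ℓ P 1 ^ 2 / mgf ℓ P 2 = Real.exp (-(v : ℝ)) ∧
    ∫ ω, ∫ ω', min (Real.exp (ℓ ω)) (Real.exp (ℓ ω')) ∂P ∂P =
      2 / Real.sqrt Real.pi * ∫ u in Ioi (Real.sqrt (v : ℝ) / 2), Real.exp (-u ^ 2) := by
  refine ⟨Theory2.gaussian_logweight_ess hℓ hnorm, ?_⟩
  -- T2-J: normalisation forces the mean `m = −v/2`, so the law of `ℓ` is `noiseLaw v`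
  have hm : m = -(v : ℝ) / 2 := (Theory2.gaussian_logweight_law hℓ hnorm).1
  have hlaw : P.map ℓ = noiseLaw v := by
    rw [hℓ, hm, noiseLaw, neg_div]
  -- push both integrals forward along `ℓ`
  have hin : ∀ x, ∫ ω', min (Real.exp x) (Real.exp (ℓ ω')) ∂P =
      ∫ y, min (Real.exp x) (Real.exp y) ∂(noiseLaw v) := by
    intro x
    rw [← hlaw, integral_map hℓm]
    exact (continuous_const.min Real.continuous_exp).aestronglyMeasurable
  simp_rw [hin]
  have hG : StronglyMeasurable fun x : ℝ => ∫ y, min (Real.exp x) (Real.exp y) ∂(noiseLaw v) := by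
    have hunc : StronglyMeasurable
        (Function.uncurry fun x y : ℝ => min (Real.exp x) (Real.exp y)) :=
      ((Real.continuous_exp.comp continuous_fst).min
        (Real.continuous_exp.comp continuous_snd)).stronglyMeasurable
    exact hunc.integral_prod_right
  have key : ∫ x, (∫ y, min (Real.exp x) (Real.exp y) ∂(noiseLaw v)) ∂(P.map ℓ) =
      ∫ ω, (∫ y, min (Real.exp (ℓ ω)) (Real.exp y) ∂(noiseLaw v)) ∂P :=
    integral_map (f := fun x => ∫ y, min (Real.exp x) (Real.exp y) ∂(noiseLaw v)) hℓm
      (by rw [hlaw]; exact hG.aestronglyMeasurable)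
  rw [← key, hlaw]
  exact imh_lognormal_accRate_eq_erfc hv

end Dictionary

end Summit.Ventures.LatticeQCDFlow.Scoring
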